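import Summits.QuantumFields.BalabanUV.Beta.MultiscaleRegularityOfMeanValue
import Summits.QuantumFields.BalabanUV.Beta.HarmonicMeasureBoundD4

/-!
# `Summit.QuantumFields.BalabanUV.Beta.MultiscaleRegularityD4` — O.2 item (ii-b) FOR THE MODEL IN BAŁABAN'S DIMENSION d = 4, WITHOUT
# HYPOTHESIS: file 16c's END (the sup member (3.42)₁'s SHAPE for `levelOp`, sitewise, level-free) with its mean-value binder
# DISCHARGED by `HarmonicMeasureBoundD4.hMV_d4` — road P3's kernel proof of the harmonic-measure bound via the lattice Newton potential

HONEST FRAMING (page 1 of everything in this cell).  Discharging `FlowStep.BetaPertH` would make Bałaban's ultraviolet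
stability UNCONDITIONAL — a constructive-QFT result; it is NOT the continuum limit and NOT the Clay problem.  This module
discharges nothing of `BetaPertH`; it is a [folklore] composition of kernel theorems about the MODEL operator, by CO-OWNER #3 of binder
row D4 (unit `b2b-balaban-beta-d4-p3`, road P3 «reduction road», gen 12).  HONEST DEPENDENCY: continuum YM on T⁴ ⇐ BetaPertH ∧ nine
spine estimates (0/9 proved); BetaPertH ⇐ (D1) ∧ (D4) ∧ CAP+tail; G-an2-4 gates asym, D1 and NE2/3/4.

THE POINT.  The row-D4 owner's `MultiscaleRegularityOfMeanValue.real_sup_levelOp_inverse_le_of_meanValue` (16c) = file 9b's sup member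
for the multi-region averaged MODEL operator `levelOp` with `hreg` discharged MODULO the L¹ mean-value binder (MV) for the free
Laplacian on torus boxes.  `HarmonicMeasureBoundD4.hMV_d4` = (MV) for every torus `Π_{μ<4} ℤ/N_μ`, `C_MV = max(1, 6⁴·48)`, proved from
the explicit lattice-superharmonic Newton potential `1/(|x − x₀|² + 3)` (Green comparison, last exit, radius averaging).  THIS FILE:
**`real_sup_levelOp_inverse_le_d4`** — 16c's END for `d = 4` with NO binder: in the MODEL setting of `MultiscaleDecay.hc_levelOp`
(cube cells of graded sides `S_l = L^{e_l}`, ANY column-orthonormal bond matrices `Rm` and block isometries `T`, the (P) budget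
`hscale`, a CONSTANT bond weight `c ≡ c₀ ≠ 0`, cell-sum coercivity `C`, the sitewise additive grading, the rate condition
`(1 + d/2)(log L/R) ≤ κ`), for `u` supported in cell `k′` with `|u| ≤ m` and every `p = (x,i)`:
`|((levelOp)⁻¹u)(p)| ≤ (c₁K₁ + c₂K₂)·n(x)²·e^{−(κ − 3·log L/R)·d_n(x,t_{k′})}·m` with 16c's constants at `C_MV = max(1, 6⁴·48)` —
print's «|(G′(U)λ)(x)| ≦ B₀(L^jη)²e^{−δ₀d(y,y′)}|λ|» SHAPE ([B9] (3.42)₁) for the MODEL, HYPOTHESIS-FREE in d = 4.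
WHAT THIS IS NOT: nothing of Bałaban's `G′(U)`, regions `Ω_j`, or field is instantiated; the MODEL's (ii-b) is one item of the owner's
decomposition of the located datum `hreg` (E-an4-141a), at MODEL level; for print the corresponding input is [B4] Lemma 2.2's
(p,q)-chain ∕ [B6] Prop. 2.2 — LOCATORS only.  Row D4's class for BAŁABAN is UNCHANGED.  STATUS IN THE ROW: co-owner beta-d4-p2's
`SubsolutionMeanValueL1.hMV_holds` (De Giorgi iteration, general `d`, `10r + 4 ≤ N_μ`) is the PRIMARY kernel route to the same binder
(owner's ruling R-an4-45-1); this file is the SECOND, technique-distinct engine for `d = 4` — an independent cross-check.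

LOCATORS (shape only, nothing printed asserted; ABSOLUTE RULE): [Balaban1985BackgroundPropagators] Thm 3.1 (3.42) p. 397;
[Balaban1983RegularityDecay] Lemma 2.2 (2.17) pp. 577–578; [Balaban1984PropagatorsII] Prop. 2.2 (2.67) p. 234.  Row D4: NO class
change (critical-path width 0; D4 DISCHARGE NO DATE); NOT BetaPertH, NOT continuum, NOT Clay, NOT summit progress.
-/

open scoped BigOperators
open Finset

namespace Summit.QuantumFields.BalabanUV.Beta.MultiscaleRegularityD4

open Summit.QuantumFields.BalabanUV.Beta.BoxPoincare (Box)
open Summit.QuantumFields.BalabanUV.Beta.MultiscaleCoerciveTorus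
open Summit.QuantumFields.BalabanUV.Beta.MultiscaleDistance
open Summit.QuantumFields.BalabanUV.Beta.MultiscaleDecayBudget
open Summit.QuantumFields.BalabanUV.Beta.MultiscaleSupMember (real_sup_levelOp_inverse_le_of_regularity)
open Summit.QuantumFields.BalabanUV.Beta.MultiscaleRegularityOfMeanValue (real_sup_levelOp_inverse_le_of_meanValue)
open Summit.QuantumFields.BalabanUV.Beta.HarmonicMeasureBoundD4 (hMV_d4)
open Summit.QuantumFields.BalabanUV.Beta.MultiscaleBoxDistance (scale_ge_of_sdist_le sdist_le_of_dist_le)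
open Summit.QuantumFields.BalabanUV.Beta.TorusBoxSupersolution (fibreNorm_le_l2_box)
open Summit.QuantumFields.BalabanUV.Beta.MultiscaleRegularitySource
open Literature.MathematicalPhysics.QuantumFieldTheory.Balaban1983to89
open Literature.MathematicalPhysics.QuantumFieldTheory.Balaban1983to89.B9Thm37Glue (covD covDT)
open Literature.MathematicalPhysics.QuantumFieldTheory.Balaban1983to89.B9Thm37GluePU (bsrc btgt)
open Literature.MathematicalPhysics.QuantumFieldTheory.Balaban1983to89.B9Thm37GlueTorusCov (tblk)
open Literature.MathematicalPhysics.QuantumFieldTheory.Balaban1983to89.B9Thm37GlueTorusCovLevels (levelOp levelSum)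
open B5TorusCover (UT Ctr ctrU)
open B5Leibniz121 (up dn)

noncomputable section

variable {d : ℕ} {N : Fin d → ℕ} [∀ i, NeZero (N i)] [NeZero d] {Cp J K : Type} [Fintype Cp] [DecidableEq Cp] [Nonempty Cp]
  [Fintype J] [Fintype K] [DecidableEq K] (S : J → ℕ) (hS : ∀ l, 1 ≤ S l) (hdivS : ∀ l i, S l ∣ N i) (lvl : K → J)
  (zc : (k : K) → Ctr N (S (lvl k)))
  (hdisj : ∀ k k' v v', cellPt S hS hdivS lvl zc k v = cellPt S hS hdivS lvl zc k' v' → k = k')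
  (hcover : ∀ x : UT N, ∃ k, ∃ v : Box d (S (lvl k)), cellPt S hS hdivS lvl zc k v = x)
  (Rm : UT N × Fin d → Cp → Cp → ℝ) (hRm : ∀ b i j, ∑ k, Rm b k i * Rm b k j = if i = j then (1 : ℝ) else 0)
  (T : J → UT N → Cp → Cp → ℝ) (hT : ∀ l x i i', ∑ k, T l x k i * T l x k i' = if i = i' then (1 : ℝ) else 0)
  (a : J → ℝ) (ha : ∀ j, 0 ≤ a j) (ω : J → UT N → ℝ)
  (hsupp : ∀ l x, ω l (ctrU N (S l) (tblk (hS l) (hdivS l) x)) ≠ 0 → ∃ k v, lvl k = l ∧ cellPt S hS hdivS lvl zc k v = x)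
  {amax : ℝ} (hamax : 0 ≤ amax)
  (hscale : ∀ k, a (lvl k) * ω (lvl k) (ctrU N (S (lvl k)) (zc k)) ^ 2 * (S (lvl k) : ℝ) ^ d ≤ amax / (S (lvl k) : ℝ) ^ 2)
  (c : UT N × Fin d → ℝ) {c₀ : ℝ} (hcc : ∀ b, c b = c₀) (hc₀ : c₀ ≠ 0)
  {L : ℕ} (hL : 1 ≤ L) (e : J → ℕ) (hSe : ∀ l, S l = L ^ e l) {R : ℝ} (hR : 0 < R) {A : ℕ}
  (hadd : ∀ x y : UT N, |(e (lvl (cellOf S hS hdivS lvl zc hcover x)) : ℝ) - e (lvl (cellOf S hS hdivS lvl zc hcover y))| ≤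
    A + sdist bsrc btgt (siteScale S hS hdivS lvl zc hcover) x y / R)

include hdisj hT ha hsupp hamax hscale hL e hSe hR hadd hRm hcc hc₀


/-! ## THE END: the sup member (3.42)₁'s SHAPE for `levelOp`, d = 4, hypothesis-free -/

/-- **THE SUP-NORM MEMBER'S SHAPE FOR `levelOp`, SITEWISE, LEVEL-FREE, HYPOTHESIS-FREE IN d = 4.**  File 16c's
`real_sup_levelOp_inverse_le_of_meanValue` with the mean-value binder supplied by `HarmonicMeasureBoundD4.hMV_d4`
(`C_MV = max(1, 6⁴·48)`): in the MODEL setting of `MultiscaleDecay.hc_levelOp` on a torus `Π_{μ<4} ℤ/N_μ` (`d = 4`) with a constant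
bond weight `c ≡ c₀ ≠ 0`, the additive grading and the rate condition `(1 + d/2)(log L/R) ≤ κ`, `Γ = L^A·e^{(log L/R)(4d+1)}`,
`θ = 1/(4dΓ)`: for `u` supported in cell `k′` with `|u| ≤ m` and every `p = (x,i)`,
`|((levelOp)⁻¹u)(p)| ≤ (c₁K₁ + c₂K₂)·n(x)²·e^{−(κ − (1+d/2)log L/R)·d_n(x,t_{k′})}·m` with 16c's constants at `C_MV = max(1, 6⁴·48)`.
No (MV), no (HMB), no leaf: road P3's `GraphHarmonicExtension` → `GraphPoissonKernel` → `MeanValueFromPoisson` → `TorusBallMeanValue`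
→ `MeanValueBinderOfPoissonBound` → `GraphGreenFunction` → `LatticeNewtonPotentialD4` → `HarmonicMeasureBoundD4` behind it are KERNEL.
[cite: Balaban1985BackgroundPropagators, Thm 3.1 (3.42) p.397; Balaban1984PropagatorsII, Prop. 2.2 (2.67) p.234] [folklore] -/
theorem real_sup_levelOp_inverse_le_d4 (hd : d = 4) {cmax : ℝ} (hc : ∀ b, |c b| ≤ cmax) {C : ℝ}
    (hcoer : ∀ f : UT N × Cp → ℝ,
      C * ∑ k, ((S (lvl k) : ℝ) ^ 2)⁻¹ * ∑ v : Box d (S (lvl k)), ∑ i, f (cellPt S hS hdivS lvl zc k v, i) ^ 2 ≤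
        ∑ p, f p * levelOp bsrc btgt c Rm (fun l x => ctrU N (S l) (tblk (hS l) (hdivS l) x))
          (fun l x => ω l (ctrU N (S l) (tblk (hS l) (hdivS l) x))) T a f p)
    {κ : ℝ} (hκ0 : 0 ≤ κ) (hκ1 : κ ≤ 1) (hμ : 0 < C - 2 * d * cmax ^ 2 * κ ^ 2 - amax * (Real.exp (2 * d * κ) - 1))
    (hrate : (1 + d / 2) * (Real.log L / R) ≤ κ)
    {Γ θ : ℝ} (hΓ : Γ = (L : ℝ) ^ A * Real.exp (Real.log L / R * (4 * d + 1))) (hθ : θ = 1 / (4 * d * Γ))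
    (k' : K) (u : UT N × Cp → ℝ) (hu : ∀ p, cellOf S hS hdivS lvl zc hcover p.1 ≠ k' → u p = 0)
    {m : ℝ} (hm : 0 ≤ m) (hum : ∀ p, |u p| ≤ m) (p : UT N × Cp) :
    |(Ring.inverse (levelOp bsrc btgt c Rm (fun l x => ctrU N (S l) (tblk (hS l) (hdivS l) x))
        (fun l x => ω l (ctrU N (S l) (tblk (hS l) (hdivS l) x))) T a)) u p| ≤
      ((max 1 (6 ^ 4 * 48) / Real.sqrt (θ ^ d) +
            Real.sqrt (Fintype.card Cp) * (θ + 1) ^ 2 * (amax * Γ ^ 2 * Real.sqrt (Γ ^ d)) / (2 * c₀ ^ 2)) *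
          (Real.sqrt (Fintype.card Cp) * Real.exp (κ * ((4 * d + 1) + 2 * d)) *
            ((L : ℝ) ^ A * Real.exp (Real.log L / R * (4 * d + 1))) * (L : ℝ) ^ A * Real.sqrt (((L : ℝ) ^ A) ^ d) /
            (C - 2 * d * cmax ^ 2 * κ ^ 2 - amax * (Real.exp (2 * d * κ) - 1))) +
          Real.sqrt (Fintype.card Cp) * (θ + 1) ^ 2 / (2 * c₀ ^ 2) *
            Real.exp ((κ - (1 + d / 2) * (Real.log L / R)) * ((4 * d + 1) + 2 * d))) *
        (siteScale S hS hdivS lvl zc hcover p.1 : ℝ) ^ 2 *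
        Real.exp (-((κ - (1 + d / 2) * (Real.log L / R)) *
          sdist bsrc btgt (siteScale S hS hdivS lvl zc hcover) p.1 (ctrU N (S (lvl k')) (zc k')))) * m := by
  subst hd
  exact real_sup_levelOp_inverse_le_of_meanValue S hS hdivS lvl zc hdisj hcover Rm hRm T hT a ha ω hsupp hamax hscale c hcc hc₀ hL e
    hSe hR hadd hc hcoer hκ0 hκ1 hμ hrate hΓ hθ (le_max_left 1 _) hMV_d4 k' u hu hm hum p

end

end Summit.QuantumFields.BalabanUV.Beta.MultiscaleRegularityD4
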